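import Mathlib
import Summits.KontsevichZagierPeriods.KontsevichZagierPeriods.Theorems.InverseLandauTateFamilyKernelStubPrimitiveAlgebra
import Summits.KontsevichZagierPeriods.KontsevichZagierPeriods.Theorems.InverseLandauTateFamilyKernelStubPrimitiveWalls
import Summits.KontsevichZagierPeriods.KontsevichZagierPeriods.Theorems.InverseLandauTateFamilyKernelStubTowerSplit
import Summits.KontsevichZagierPeriods.KontsevichZagierPeriods.Theorems.InverseLandauTateFamilyKernelStubTowerBind
import Summits.KontsevichZagierPeriods.KontsevichZagierPeriods.Theorems.InverseLandauTateFamilyKernelTateAnchor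
import Summits.KontsevichZagierPeriods.KontsevichZagierPeriods.Theorems.InverseLandauTateFamilyKernelRationalCertificate
import Summits.KontsevichZagierPeriods.KontsevichZagierPeriods.Theorems.InverseLandauTateFamilyKernelStubFaceRationalIdentity

/-!
# Crux `TateFamilyKernel` (stmt-KontsevichZagierPeriods-9130), line `Sketch`:
# stub `stub_qhFaceExactE` (wave 15 assembly — the tame primitive `E` of the telescoped face
# family on the `(s,t)`-square)

Variables at the `(s,ϖ)`-level: `X 0 = s`, `X 1 = ϖ` (polynomials in `MvPolynomial (Fin 2) ℚ`);
on the `(s,t)`-square the parameter is reparametrised as `ϖ = ϖ₀t^d`, i.e. one substitutes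
`φ := bind₁ ![X 0, X 2 * X 1 ^ d]` into `MvPolynomial (Fin (2 + 1)) ℚ` (`X 0 = s`, `X 1 = t`,
`X 2 ↦ ϖ₀`) and evaluates at `Fin.snoc y ϖ₀`, `y = (s,t) ∈ [0,1]²`.

From the remainder-free Hermite identities of the two grouped faces (`hHab`) the landed
`stub_primitiveAlgebra` produces the rational primitive `N_E/(cD̂)` of the face integrand
`N_a/D_a^{k+1} + N_b/D_b^{k+1}` (`k = #W − 1`) in cross-multiplied form, and the landed
`stub_primitiveWalls` removes its walls on the band `[0,1] × [0,ϖ₀]` using the vanishing face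
integrals on `(0,b₁)`: new data `N_E', c'` with `c' ≠ 0` on `[0,ϖ₀]`, the same identity, and
`N_E'(0,ϖ) ≡ N_E'(1,ϖ) ≡ 0`. The primitive on the square is

  `E(y) := (φ N_E')(y, ϖ₀) / (φ (c'·D̂))(y, ϖ₀) = N_E'(s, ϖ₀t^d) / (c'D̂)(s, ϖ₀t^d)`.

* It is analytic near the square and `ℚ`-semialgebraic on it (`analyticAt_aeval_div_aeval_snoc`,
  `isSemialgebraicFunOn_aeval_div_aeval_comp` of the Tate anchor file): the denominator does not
  vanish there since `ϖ₀t^d ∈ [0,ϖ₀]` and `D_a, D_b, D_a(0,·), D_b(0,·), c'` do not vanish on the band.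
* `E(1,t) = E(0,t) = 0` by `N_E'(1,ϖ) = N_E'(0,ϖ) = 0`.
* Its `s`-derivative at `y` is `N_a/D_a^{k+1} + N_b/D_b^{k+1}` at `(s, ϖ₀t^d)` (quotient rule against
  the cross-multiplied identity, `PrimitiveWalls.hasDerivAt_quot`), which is regrouped termwise
  into the 3-variable tower form `Σ_{w,i} e_{w,i} · (d^i φ(Ns w i))/(φ(D_aD_b))^{i+1}` using
  `N_a = Σ e_{w,i}d^i · NAs w i · D_a^{k−i}`, the tower split `Ns w i = NAs w i·D_b^{i+1} + NBs w i·D_a^{i+1}`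
  (`stub_towerSplit`) and `φ(D_aD_b) = D_{ab}` (`TowerBind.bind₁_den`).

Mathlib plus the landed sibling files; no named fact, no new definition. Helpers live in the
sub-namespace `QhFaceExactE`.
-/

noncomputable section

open MeasureTheory Set MvPolynomial
open Literature.NumberTheory.Transcendental

namespace Summit.KontsevichZagierPeriods.InverseLandau.TateFamilyKernel.Descent

namespace QhFaceExactE

/-- **Evaluation of the reparametrisation `ϖ = ϖ₀t^d`.** For `P ∈ ℚ[s, ϖ]` and `y = (s, t)`:
`(φ P)(y, ϖ₀) = P(s, ϖ₀t^d)` with `φ = bind₁ ![X 0, X 2 * X 1 ^ d]`. [folklore] -/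
theorem aeval_snoc_bind₁ (d : ℕ) (ϖ₀ : ℝ) (y : Fin 2 → ℝ) (P : MvPolynomial (Fin 2) ℚ) :
    aeval (Fin.snoc y ϖ₀ : Fin (2 + 1) → ℝ)
        (bind₁ ![X 0, X 2 * X 1 ^ d] P : MvPolynomial (Fin (2 + 1)) ℚ) =
      aeval (![y 0, ϖ₀ * y 1 ^ d] : Fin 2 → ℝ) P := by
  have h : (fun i => aeval (Fin.snoc y ϖ₀ : Fin (2 + 1) → ℝ)
      ((![X 0, X 2 * X 1 ^ d] : Fin 2 → MvPolynomial (Fin (2 + 1)) ℚ) i)) =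
      ![y 0, ϖ₀ * y 1 ^ d] := by
    funext i
    fin_cases i <;> simp [EulerDivergence.snoc_apply_one, EulerDivergence.snoc_apply_two]
  rw [aeval_bind₁, h]

/-- **Termwise regrouping** of the face integrand into the tower form (real numbers, `i ≤ k`,
`α, β ≠ 0`): `eDAα^{k−i}/α^{k+1} + eDBβ^{k−i}/β^{k+1} = e·(D(Aβ^{i+1} + Bα^{i+1})/(αβ)^{i+1})`.
[folklore] -/
theorem regroup_term {e D A B α β : ℝ} {k i : ℕ} (hik : i ≤ k) (hα : α ≠ 0) (hβ : β ≠ 0) :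
    e * D * A * α ^ (k - i) / α ^ (k + 1) + e * D * B * β ^ (k - i) / β ^ (k + 1) =
      e * (D * (A * β ^ (i + 1) + B * α ^ (i + 1)) / (α * β) ^ (i + 1)) := by
  obtain ⟨j, rfl⟩ := Nat.exists_eq_add_of_le hik
  rw [Nat.add_sub_cancel_left, mul_pow]
  field_simp
  ring

end QhFaceExactE

open QhFaceExactE in
/-- **The tame primitive `E` of the telescoped face family on the `(s,t)`-square** (registered stub
`stub_qhFaceExactE`, wave 15 assembly). From the remainder-free Hermite identities of the two faces and the
vanishing face integrals on `(0,b₁)`, `b₁ ≤ ϖ₀`: `stub_primitiveAlgebra` and `stub_primitiveWalls` give `N_E', c'`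
with `c' ≠ 0` on `[0,ϖ₀]`; `E(s,t) := N_E'/(c'D̂)` at `ϖ = ϖ₀t^d` is analytic near the square, `ℚ`-semialgebraic,
has `s`-derivative `ĵ_L` in the 3-variable tower form of `stub_eulerBandMulti` (via `stub_towerSplit` and the
reparametrisation of `stub_towerBind`), and `E(1,t) = E(0,t)` (`= 0`). [folklore] -/
theorem stub_qhFaceExactE (a b d : ℕ) (T : MvPolynomial (Fin 2) ℚ) (W : Finset ℕ) (hWne : W.Nonempty)
    (Pw : ℕ → MvPolynomial (Fin 2) ℚ) (Ns : ℕ → ℕ → MvPolynomial (Fin (1 + 1)) ℚ)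
    (hNs0 : ∀ w, Ns w 0 =
      C (a : ℚ) * bind₁ ![C 1, X 0] (Pw w) * (1 - X 1 * bind₁ ![X 0, C 1] T) +
        C (b : ℚ) * bind₁ ![X 0, C 1] (Pw w) * (1 - X 1 * bind₁ ![C 1, X 0] T))
    (hNsS : ∀ w i, Ns w (i + 1) =
      X 1 * (pderiv 1 (Ns w i) * ((1 - X 1 * bind₁ ![C 1, X 0] T) * (1 - X 1 * bind₁ ![X 0, C 1] T)) -
        C ((i : ℚ) + 1) * Ns w i * pderiv 1 ((1 - X 1 * bind₁ ![C 1, X 0] T) * (1 - X 1 * bind₁ ![X 0, C 1] T))))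
    (NAs NBs : ℕ → ℕ → MvPolynomial (Fin (1 + 1)) ℚ)
    (hNA0 : ∀ w, NAs w 0 = C (a : ℚ) * bind₁ ![C 1, X 0] (Pw w))
    (hNAS : ∀ w i, NAs w (i + 1) =
      X 1 * (pderiv 1 (NAs w i) * (1 - X 1 * bind₁ ![C 1, X 0] T) -
        C ((i : ℚ) + 1) * NAs w i * pderiv 1 (1 - X 1 * bind₁ ![C 1, X 0] T)))
    (hNB0 : ∀ w, NBs w 0 = C (b : ℚ) * bind₁ ![X 0, C 1] (Pw w))
    (hNBS : ∀ w i, NBs w (i + 1) =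
      X 1 * (pderiv 1 (NBs w i) * (1 - X 1 * bind₁ ![X 0, C 1] T) -
        C ((i : ℚ) + 1) * NBs w i * pderiv 1 (1 - X 1 * bind₁ ![X 0, C 1] T)))
    (τa τb : Polynomial ℚ)
    (hτaT : Polynomial.aeval (X 0 : MvPolynomial (Fin 2) ℚ) τa = bind₁ ![C 1, X 0] T)
    (hτbT : Polynomial.aeval (X 0 : MvPolynomial (Fin 2) ℚ) τb = bind₁ ![X 0, C 1] T)
    (ca cb : Polynomial ℚ) (Ma Mb : MvPolynomial (Fin 2) ℚ) (hca : ca ≠ 0) (hcb : cb ≠ 0)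
    (hHab : Polynomial.aeval (X 1 : MvPolynomial (Fin 2) ℚ) ca *
        (∑ w ∈ W, ∑ i ∈ Finset.range W.card,
          C (((∏ v ∈ W.erase w, (Polynomial.X + Polynomial.C ((v + a + b : ℕ) : ℚ))).coeff i : ℚ) * (d : ℚ) ^ i) * NAs w i * (1 - X 1 * Polynomial.aeval (X 0 : MvPolynomial (Fin 2) ℚ) τa) ^ (W.card - 1 - i)) =
        pderiv 0 Ma * (1 - X 1 * Polynomial.aeval (X 0 : MvPolynomial (Fin 2) ℚ) τa) -
          C ((W.card - 1 : ℕ) : ℚ) * (Ma * pderiv 0 (1 - X 1 * Polynomial.aeval (X 0 : MvPolynomial (Fin 2) ℚ) τa)) ∧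
      Polynomial.aeval (X 1 : MvPolynomial (Fin 2) ℚ) cb *
        (∑ w ∈ W, ∑ i ∈ Finset.range W.card,
          C (((∏ v ∈ W.erase w, (Polynomial.X + Polynomial.C ((v + a + b : ℕ) : ℚ))).coeff i : ℚ) * (d : ℚ) ^ i) * NBs w i * (1 - X 1 * Polynomial.aeval (X 0 : MvPolynomial (Fin 2) ℚ) τb) ^ (W.card - 1 - i)) =
        pderiv 0 Mb * (1 - X 1 * Polynomial.aeval (X 0 : MvPolynomial (Fin 2) ℚ) τb) -
          C ((W.card - 1 : ℕ) : ℚ) * (Mb * pderiv 0 (1 - X 1 * Polynomial.aeval (X 0 : MvPolynomial (Fin 2) ℚ) τb)))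
    (ϖ₀ : ℝ) (halg : IsAlgebraic ℚ ϖ₀) (hϖ₀ : 0 < ϖ₀)
    (hband : ∀ s ∈ Icc (0 : ℝ) 1, ∀ ϖ ∈ Icc (0 : ℝ) ϖ₀,
      1 - ϖ * Polynomial.aeval s τa ≠ 0 ∧ 1 - ϖ * Polynomial.aeval s τb ≠ 0)
    (b₁ : ℝ) (hb₁ : 0 < b₁) (hb₁ϖ₀ : b₁ ≤ ϖ₀)
    (hfv : ∀ ϖ ∈ Ioo (0 : ℝ) b₁, (∀ s ∈ Icc (0 : ℝ) 1,
          1 - ϖ * Polynomial.aeval s τa ≠ 0 ∧ 1 - ϖ * Polynomial.aeval s τb ≠ 0) ∧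
        ∫ s in (0 : ℝ)..1,
          (aeval (![s, ϖ] : Fin 2 → ℝ)
              (∑ w ∈ W, ∑ i ∈ Finset.range W.card,
          C (((∏ v ∈ W.erase w, (Polynomial.X + Polynomial.C ((v + a + b : ℕ) : ℚ))).coeff i : ℚ) * (d : ℚ) ^ i) * NAs w i * (1 - X 1 * Polynomial.aeval (X 0 : MvPolynomial (Fin 2) ℚ) τa) ^ (W.card - 1 - i)) / (1 - ϖ * Polynomial.aeval s τa) ^ (W.card - 1 + 1) +
            aeval (![s, ϖ] : Fin 2 → ℝ)
              (∑ w ∈ W, ∑ i ∈ Finset.range W.card,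
          C (((∏ v ∈ W.erase w, (Polynomial.X + Polynomial.C ((v + a + b : ℕ) : ℚ))).coeff i : ℚ) * (d : ℚ) ^ i) * NBs w i * (1 - X 1 * Polynomial.aeval (X 0 : MvPolynomial (Fin 2) ℚ) τb) ^ (W.card - 1 - i)) / (1 - ϖ * Polynomial.aeval s τb) ^ (W.card - 1 + 1)) = 0) :
    ∃ E : (Fin 2 → ℝ) → ℝ, AnalyticOnNhd ℝ E (KZ.cube 2) ∧ IsSemialgebraicFunOn ℚ (KZ.cube 2) E ∧
      (∀ y ∈ KZ.cube 2, HasDerivAt (fun σ : ℝ => E (Function.update y 0 σ))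
          (∑ w ∈ W, ∑ i ∈ Finset.range W.card,
            (((∏ v ∈ W.erase w, (Polynomial.X + Polynomial.C ((v + a + b : ℕ) : ℚ))).coeff i : ℚ) : ℝ) *
              (aeval (Fin.snoc y ϖ₀ : Fin (2 + 1) → ℝ) (C ((d : ℚ) ^ i) * bind₁ ![X 0, X 2 * X 1 ^ d] (Ns w i)) /
                aeval (Fin.snoc y ϖ₀ : Fin (2 + 1) → ℝ)
                  (((1 - X 2 * X 1 ^ d * bind₁ ![C 1, X 0] T) * (1 - X 2 * X 1 ^ d * bind₁ ![X 0, C 1] T)) ^ (i + 1))))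
          (y 0)) ∧
      (∀ y ∈ KZ.cube 2, E (Function.update y 0 1) = E (Function.update y 0 0)) := by
  classical
  set k : ℕ := W.card - 1 with hk
  have hWc : 0 < W.card := Finset.card_pos.2 hWne
  -- (1) the rational primitive of the exact face family; (2) removal of its walls on the band
  obtain ⟨NE, c, hc, hNE0, hii⟩ :=
    stub_primitiveAlgebra τa τb k _ _ Ma Mb ca cb hca hcb hHab.1 hHab.2
  obtain ⟨N', c', hc', hii', hN'0, hN'1⟩ := stub_primitiveWalls τa τb k _ _ NE c hc hNE0 hii ϖ₀ hϖ₀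
    hband b₁ hb₁ hb₁ϖ₀ fun ϖ hϖ => (hfv ϖ hϖ).2
  clear hii hNE0
  -- the split of the combined tower into the two one-face towers
  have hsplit := stub_towerSplit a b T Pw Ns NAs NBs hNs0 hNsS hNA0 hNAS hNB0 hNBS
  -- real values of the face denominators written through `T`
  have hDa2 : ∀ s ϖ : ℝ, aeval (![s, ϖ] : Fin 2 → ℝ)
      (1 - X 1 * bind₁ ![C 1, X 0] T : MvPolynomial (Fin (1 + 1)) ℚ) =
        1 - ϖ * Polynomial.aeval s τa := fun s ϖ => by
    rw [← hτaT]
    exact PrimitiveWalls.aeval_faceDen s ϖ τa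
  have hDb2 : ∀ s ϖ : ℝ, aeval (![s, ϖ] : Fin 2 → ℝ)
      (1 - X 1 * bind₁ ![X 0, C 1] T : MvPolynomial (Fin (1 + 1)) ℚ) =
        1 - ϖ * Polynomial.aeval s τb := fun s ϖ => by
    rw [← hτbT]
    exact PrimitiveWalls.aeval_faceDen s ϖ τb
  -- names: the face denominators `D_a, D_b` and the denominator `G = c'·D̂` of the primitive
  set Da : MvPolynomial (Fin 2) ℚ := 1 - X 1 * Polynomial.aeval (X 0 : MvPolynomial (Fin 2) ℚ) τa
    with hDa
  set Db : MvPolynomial (Fin 2) ℚ := 1 - X 1 * Polynomial.aeval (X 0 : MvPolynomial (Fin 2) ℚ) τb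
    with hDb
  set G : MvPolynomial (Fin 2) ℚ := Polynomial.aeval (X 1 : MvPolynomial (Fin 2) ℚ) c' *
    (Da ^ k * Db ^ k * (1 - X 1 * C (Polynomial.eval 0 τa)) ^ k *
      (1 - X 1 * C (Polynomial.eval 0 τb)) ^ k) with hG
  have hDa_ev : ∀ s ϖ : ℝ, aeval (![s, ϖ] : Fin 2 → ℝ) Da = 1 - ϖ * Polynomial.aeval s τa :=
    fun s ϖ => PrimitiveWalls.aeval_faceDen s ϖ τa
  have hDb_ev : ∀ s ϖ : ℝ, aeval (![s, ϖ] : Fin 2 → ℝ) Db = 1 - ϖ * Polynomial.aeval s τb :=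
    fun s ϖ => PrimitiveWalls.aeval_faceDen s ϖ τb
  have hG_ne : ∀ s ∈ Icc (0 : ℝ) 1, ∀ ϖ ∈ Icc (0 : ℝ) ϖ₀, aeval (![s, ϖ] : Fin 2 → ℝ) G ≠ 0 := by
    intro s hs ϖ hϖ
    have h0 := hband 0 (left_mem_Icc.2 zero_le_one) ϖ hϖ
    have h1 := hband s hs ϖ hϖ
    rw [hG, FaceRationalIdentity.aeval_cmul]
    simp only [map_mul, map_pow, hDa_ev, hDb_ev, PrimitiveWalls.aeval_faceDen_zero]
    exact mul_ne_zero (hc' ϖ hϖ) (mul_ne_zero (mul_ne_zero (mul_ne_zero (pow_ne_zero _ h1.1)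
      (pow_ne_zero _ h1.2)) (pow_ne_zero _ h0.1)) (pow_ne_zero _ h0.2))
  -- on the square, the reparametrised parameter `ϖ₀t^d` lies in `[0, ϖ₀]`
  have hϖy : ∀ y ∈ KZ.cube 2, ϖ₀ * y 1 ^ d ∈ Icc (0 : ℝ) ϖ₀ := fun y hy =>
    ⟨mul_nonneg hϖ₀.le (pow_nonneg (hy 1).1 d),
      mul_le_of_le_one_right hϖ₀.le (pow_le_one₀ (hy 1).1 (hy 1).2)⟩
  -- evaluations on the square of the reparametrised tower data
  have hDab_ev : ∀ (y : Fin 2 → ℝ) (n : ℕ), aeval (Fin.snoc y ϖ₀ : Fin (2 + 1) → ℝ)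
      (((1 - X 2 * X 1 ^ d * bind₁ ![C 1, X 0] T) * (1 - X 2 * X 1 ^ d * bind₁ ![X 0, C 1] T)) ^ n :
        MvPolynomial (Fin (2 + 1)) ℚ) =
      ((1 - ϖ₀ * y 1 ^ d * Polynomial.aeval (y 0) τa) *
        (1 - ϖ₀ * y 1 ^ d * Polynomial.aeval (y 0) τb)) ^ n := by
    intro y n
    rw [map_pow, ← TowerBind.bind₁_den, aeval_snoc_bind₁, map_mul, hDa2, hDb2]
  have hNs_ev : ∀ (y : Fin 2 → ℝ) (w i : ℕ), aeval (Fin.snoc y ϖ₀ : Fin (2 + 1) → ℝ)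
      (C ((d : ℚ) ^ i) * bind₁ ![X 0, X 2 * X 1 ^ d] (Ns w i) : MvPolynomial (Fin (2 + 1)) ℚ) =
      (d : ℝ) ^ i * (aeval (![y 0, ϖ₀ * y 1 ^ d] : Fin 2 → ℝ) (NAs w i) *
          (1 - ϖ₀ * y 1 ^ d * Polynomial.aeval (y 0) τb) ^ (i + 1) +
        aeval (![y 0, ϖ₀ * y 1 ^ d] : Fin 2 → ℝ) (NBs w i) *
          (1 - ϖ₀ * y 1 ^ d * Polynomial.aeval (y 0) τa) ^ (i + 1)) := by
    intro y w i
    rw [map_mul, MvPolynomial.aeval_C, aeval_snoc_bind₁, hsplit w i]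
    simp only [map_add, map_mul, map_pow, hDa2, hDb2, eq_ratCast, Rat.cast_natCast]
  -- the denominator of `E` does not vanish on the square
  have hden : ∀ y ∈ KZ.cube 2, aeval (Fin.snoc y ϖ₀ : Fin (2 + 1) → ℝ)
      (bind₁ ![X 0, X 2 * X 1 ^ d] G : MvPolynomial (Fin (2 + 1)) ℚ) ≠ 0 := fun y hy => by
    rw [aeval_snoc_bind₁]
    exact hG_ne _ (hy 0) _ (hϖy y hy)
  have h10 : (1 : Fin 2) ≠ 0 := by decide
  refine ⟨fun y => aeval (Fin.snoc y ϖ₀ : Fin (2 + 1) → ℝ)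
        (bind₁ ![X 0, X 2 * X 1 ^ d] N' : MvPolynomial (Fin (2 + 1)) ℚ) /
      aeval (Fin.snoc y ϖ₀ : Fin (2 + 1) → ℝ)
        (bind₁ ![X 0, X 2 * X 1 ^ d] G : MvPolynomial (Fin (2 + 1)) ℚ),
    fun y hy => analyticAt_aeval_div_aeval_snoc ϖ₀ _ _ (hden y hy),
    isSemialgebraicFunOn_aeval_div_aeval_comp
      (isSemialgebraicMapOn_snoc_const KZ.isSemialgebraic_cube halg) _ _ hden,
    fun y hy => ?_, fun y _ => ?_⟩
  · -- the `s`-derivative: quotient rule against the cross-multiplied identity, then regrouping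
    have hαβ := hband (y 0) (hy 0) (ϖ₀ * y 1 ^ d) (hϖy y hy)
    have key := PrimitiveWalls.hasDerivAt_quot hii' (ϖ₀ * y 1 ^ d) (y 0)
      (hG_ne _ (hy 0) _ (hϖy y hy)) (by rw [hDa_ev]; exact hαβ.1) (by rw [hDb_ev]; exact hαβ.2)
    refine (key.congr_of_eventuallyEq (Filter.Eventually.of_forall fun σ => ?_)).congr_deriv ?_
    · simp only [aeval_snoc_bind₁, Function.update_self, Function.update_of_ne h10]
    rw [hDa_ev, hDb_ev]
    simp only [map_sum, Finset.sum_div, ← Finset.sum_add_distrib]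
    refine Finset.sum_congr rfl fun w _ => Finset.sum_congr rfl fun i hi => ?_
    have hik : i ≤ k := by
      have := Finset.mem_range.1 hi
      omega
    rw [hDab_ev, hNs_ev]
    simp only [map_mul, map_pow, MvPolynomial.aeval_C, hDa_ev, hDb_ev, eq_ratCast, Rat.cast_natCast]
    exact regroup_term hik hαβ.1 hαβ.2
  · -- equal endpoint values: both vanish since `N_E'(1,ϖ) = N_E'(0,ϖ) = 0`
    simp only [aeval_snoc_bind₁, Function.update_self, Function.update_of_ne h10, hN'0, hN'1,
      zero_div]

end Summit.KontsevichZagierPeriods.InverseLandau.TateFamilyKernel.Descent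

end
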